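import Summits.BirchSwinnertonDyer.BirchSwinnertonDyer.Theorems.ManinLocalTwoThreeOddTameUnitTwist
import Summits.BirchSwinnertonDyer.BirchSwinnertonDyer.Theorems.ManinLocalTwoThreeDegeneracyUnitTwistSquarefull
import Summits.BirchSwinnertonDyer.Rank1Residual.ManinAdditive.TowerUnitTwist
import HarnessLib

/-!
# E-es-87, E-es-87±, E-es-89, E-es-90 HOLD — the four squarefull KP/polar witness laws of `…KatoCurveKPWitness` closed BY NAME,
# UNCONDITIONALLY (no modularity binder), and `3 ∤ c(W)` per Kosters–Pannekoek class modulo F₃♮ at `W` alone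

Summit `BirchSwinnertonDyer`, route `ManinLocalTwoThree` (cell bsd-f2-manin), crux C3 `ManinPrimeToThreeAtNine`
(stmt-BirchSwinnertonDyer-22968).  The files `…KPWitnessSquarefull` / `…KPWitnessSquarefullKPNeOne` proved these laws GIVEN
`exists_isNewformOf` (used only to get `W` additive at `3` from `9 ∣ N`).  That binder is unnecessary: the tree's
`KatoCurve.additive_of_sq_dvd_level` (typer p667119, from `IsNewformOf.dvd_level_iff_dvd_conductorNorm`) gives additivity at `p`
from `p² ∣ N` for ANY newform datum, with no modularity input.  Hence, route-cone-free and unconditional: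

* `threeAdicKPWitnessOfKPZeroSquarefull_holds` — **E-es-87** (ā = 0, squarefull, plus index prime to `3`) HOLDS;
* `threeAdicKPWitnessOfKPNeOneSquarefull_holds` — **E-es-87±** (ā ≠ +1) HOLDS (via E-es-87♭⁺ at every level, THEOREM B″);
* `threeAdicKPWitnessOfDegeneracyThreePlusIndex_holds` — **E-es-89** (ā ≠ −1, ratio-`3` degeneracy index) HOLDS;
* `threeAdicPolarWitnessOfDegeneracyNinePlusIndex_holds` — **E-es-90** (every class, ratio-`9` degeneracy index, POLAR) HOLDS;
* `threeAdicPolarWitness_squarefull_of_degeneracyLoopLawNine'` — **E-es-66 on the squarefull locus ⟸ E-es-68₉**, no other input;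
* `not_three_dvd_maninConstant_squarefull_of_kp_ne_one` / `…_of_degeneracyThree` / `…_of_degeneracyLoopLawNine'` — **`3 ∤ D.c`**
  at squarefull `9 ∣ N` modulo F₃♮ at `W` (`KatoFactThreeAtKP W D.f`) ALONE (plus the f-specific index / E-es-68₉ for ā = +1; the
  Shimura plus index discharged by a second additive prime `q ≠ 3`, `q² ∣ N`).

HONEST FRAMING: the remaining condition is Kato's KP-indexed fact F₃♮ (a Literature `def`, derived reading) — and, for ā = +1, the
ratio-`3` index or the lattice law E-es-68₉.  C3, Manin's conjecture and BSD are NOT proved by this.  No definitions, no named facts,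
no sorry.
-/

set_option linter.dupNamespace false
set_option autoImplicit false

noncomputable section

open scoped Classical MatrixGroups ModularForm ComplexConjugate

open CongruenceSubgroup Complex Literature.NumberTheory.EllipticCurves
  Literature.NumberTheory.EllipticCurves.ModularForms
  Summit.BirchSwinnertonDyer.Rank1Residual.ManinAdditive.Gamma1Lattice
  Summit.BirchSwinnertonDyer.Rank1Residual.ManinAdditive.KatoCurve

namespace Summit.BirchSwinnertonDyer.BirchSwinnertonDyer.Theorems.ManinLocalTwoThree

/-! ### §1 The four laws BY NAME, unconditionally -/

/-- **E-es-87 `ThreeAdicKPWitnessOfKPZeroSquarefull` HOLDS** (ā = 0: E-es-87♭ + additivity at `3` from `9 ∣ N` by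
`KatoCurve.additive_of_sq_dvd_level`, empty Euler product, ρ = 1). -/
theorem threeAdicKPWitnessOfKPZeroSquarefull_holds : ThreeAdicKPWitnessOfKPZeroSquarefull := by
  intro W _ _ N _ D _ h9 hsq h0 hpi
  have h3 : 3 ∣ N := dvd_trans (by norm_num) h9
  have hadd := additive_of_sq_dvd_level 3 W D.f D.isNewformOf h9
  obtain ⟨m, hm, χ, r, hcop, hprim, hne, hord, hev, hr, hu⟩ :=
    tameUnitTwistOfPlusIndexPrimeToThree D.f D.isNewformOf.1 D.isNewformOf.coeffField_eq_bot h3 hpi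
  have hempty : (N.primeFactors.filter fun ℓ ↦ ¬ ℓ ^ 2 ∣ N) = ∅ :=
    Finset.filter_eq_empty_iff.mpr fun ℓ hℓ h ↦ h (hsq ℓ hℓ)
  refine ⟨m, hm, χ, r, 1, D.isNewformOf, hadd.1, hadd.2, hcop, hprim, hne, hord, ?_, hev, by simp, ?_, ?_⟩
  · rw [h0, mul_zero]; exact zero_ne_one
  · rw [hempty, Finset.prod_empty, one_mul, hr]
  · intro s hs
    have : (s : ℂ) * r * ((1 : ℚ) : ℂ) / 3 = (s : ℂ) * r / 3 := by push_cast; ring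
    rw [this]
    exact hu s hs

/-- **E-es-87± `ThreeAdicKPWitnessOfKPNeOneSquarefull` HOLDS** (ā ≠ +1: E-es-87♭⁺ at every level via THEOREM B″, odd order
⟹ `χ(3) ≠ −1`; additivity from `9 ∣ N`). -/
theorem threeAdicKPWitnessOfKPNeOneSquarefull_holds : ThreeAdicKPWitnessOfKPNeOneSquarefull :=
  fun W _ _ _ _ D _ h9 hsq h1 hpi ↦
    threeAdicKPWitness_of_plusIndexPrimeTo_of_kp_ne_one W D (additive_of_sq_dvd_level 3 W D.f D.isNewformOf h9) h9 hsq h1 hpi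

/-- **E-es-89 `ThreeAdicKPWitnessOfDegeneracyThreePlusIndex` HOLDS** (THEOREM U (a): ratio-`3` degeneracy index ⟹ `χ(3) ≠ 1`,
the Kosters–Pannekoek clause for ā ≠ −1). -/
theorem threeAdicKPWitnessOfDegeneracyThreePlusIndex_holds : ThreeAdicKPWitnessOfDegeneracyThreePlusIndex := by
  intro W _ _ N _ D _ h9 hsq h1 hd3
  have h3 : 3 ∣ N := dvd_trans (by norm_num) h9
  have hadd := additive_of_sq_dvd_level 3 W D.f D.isNewformOf h9
  obtain ⟨m, hm, χ, r, hcop, hprim, hne, hord, h3a, hev, hr, hu⟩ :=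
    tameKPUnitTwistOfDegeneracyThreePlusIndex D.isNewformOf.1 D.isNewformOf.coeffField_eq_bot h3 hd3
  have hkp : χ (3 : ZMod m) * kpSignThree W ≠ 1 := by
    rcases kpSignThree_mem W with h | h | h
    · rw [h, mul_zero]; exact zero_ne_one
    · rw [h, mul_one]; exact h3a
    · exact absurd h h1
  have hempty : (N.primeFactors.filter fun ℓ ↦ ¬ ℓ ^ 2 ∣ N) = ∅ :=
    Finset.filter_eq_empty_iff.mpr fun ℓ hℓ h ↦ h (hsq ℓ hℓ)
  refine ⟨m, hm, χ, r, 1, D.isNewformOf, hadd.1, hadd.2, hcop, hprim, hne, hord, hkp, hev, by simp, ?_, ?_⟩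
  · rw [hempty, Finset.prod_empty, one_mul, hr]
  · intro s hs
    have : (s : ℂ) * r * ((1 : ℚ) : ℂ) / 3 = (s : ℂ) * r / 3 := by push_cast; ring
    rw [this]
    exact hu s hs

/-- **E-es-90 `ThreeAdicPolarWitnessOfDegeneracyNinePlusIndex` HOLDS** (THEOREM U (b), class-blind POLAR witness; additivity at
`3` from `9 ∣ N`). -/
theorem threeAdicPolarWitnessOfDegeneracyNinePlusIndex_holds : ThreeAdicPolarWitnessOfDegeneracyNinePlusIndex :=
  fun W _ _ _ _ D _ h9 hsq hd ↦
    threeAdicPolarWitness_of_degeneracyNinePlusIndex W D (additive_of_sq_dvd_level 3 W D.f D.isNewformOf h9) h9 hsq hd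

/-- **E-es-66 on the SQUAREFULL locus ⟸ E-es-68₉**, with NO other input (the leaf's `polarWitness_of_e90_of_lawNine` fed with
E-es-90 HOLDS). -/
theorem threeAdicPolarWitness_squarefull_of_degeneracyLoopLawNine' (h68 : DegeneracyLoopLawNine)
    (W : WeierstrassCurve ℚ) [W.IsElliptic] [W.IsGloballyMinimal] {N : ℕ} [NeZero N] (D : ModularParametrizationData W N)
    (hopt : ∀ z ∈ D.L.lattice, ∃ w ∈ periodLattice D.f, z = D.c * w)
    (h9 : 3 ^ 2 ∣ N) (hsq : IsSquarefull N) (hpi : PlusIndexPrimeTo 3 D.f) : ThreeAdicPolarWitness W W D.f :=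
  polarWitness_of_e90_of_lawNine threeAdicPolarWitnessOfDegeneracyNinePlusIndex_holds h68 W D hopt h9 hsq hpi

/-! ### §2 `3 ∤ c(W)` at squarefull level modulo F₃♮ at `W` alone -/

/-- **ā ≠ +1, composite squarefull `9 ∣ N`**: `3 ∤ D.c` modulo F₃♮ at `W` (`KatoFactThreeAtKP W D.f`) — no lattice law, no modularity
binder (E-es-87± HOLDS; plus index by the Hecke sieve at a second additive prime `q ≠ 3`). [cite: Kato2004Asterisque, Thm. 12.5 (1) (p. 221)] -/
theorem not_three_dvd_maninConstant_squarefull_of_kp_ne_one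
    (W : WeierstrassCurve ℚ) [W.IsElliptic] [W.IsGloballyMinimal] {N : ℕ} [NeZero N]
    (D : ModularParametrizationData W N) (hF : KatoFactThreeAtKP W D.f)
    (hopt : ∀ z ∈ D.L.lattice, ∃ w ∈ periodLattice D.f, z = D.c * w) (h9 : 3 ^ 2 ∣ N) (hsq : IsSquarefull N)
    (h1 : kpSignThree W ≠ 1) {q : ℕ} (hq : q.Prime) (hq3 : q ≠ 3) (hqN : q ^ 2 ∣ N) : ¬ (3 : ℤ) ∣ D.c :=
  not_three_dvd_maninConstant_of_e87pm_of_kp threeAdicKPWitnessOfKPNeOneSquarefull_holds W D hF hopt h9 hsq h1 hq hq3 hqN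

/-- **ā ≠ −1, squarefull, ratio-`3` degeneracy index**: `3 ∤ D.c` modulo F₃♮ at `W` (E-es-89 HOLDS). [cite: Kato2004Asterisque, Thm. 12.5 (1) (p. 221)] -/
theorem not_three_dvd_maninConstant_squarefull_of_degeneracyThree
    (W : WeierstrassCurve ℚ) [W.IsElliptic] [W.IsGloballyMinimal] {N : ℕ} [NeZero N]
    (D : ModularParametrizationData W N) (hF : KatoFactThreeAtKP W D.f)
    (hopt : ∀ z ∈ D.L.lattice, ∃ w ∈ periodLattice D.f, z = D.c * w) (h9 : 3 ^ 2 ∣ N) (hsq : IsSquarefull N)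
    (h1 : kpSignThree W ≠ -1) (hd3 : DegeneracyPlusIndexPrimeTo 3 3 D.f) : ¬ (3 : ℤ) ∣ D.c :=
  not_three_dvd_maninConstant_of_e89_of_kp threeAdicKPWitnessOfDegeneracyThreePlusIndex_holds W D hF hopt h9 hsq h1 hd3

/-- **Every class, composite squarefull, from E-es-68₉**: `3 ∤ D.c` modulo F₃♮ at `W` and the ratio-`9` degeneracy-loop law.
[cite: Kato2004Asterisque, Thm. 12.5 (1) (p. 221)] -/
theorem not_three_dvd_maninConstant_squarefull_of_degeneracyLoopLawNine' (h68 : DegeneracyLoopLawNine)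
    (W : WeierstrassCurve ℚ) [W.IsElliptic] [W.IsGloballyMinimal] {N : ℕ} [NeZero N]
    (D : ModularParametrizationData W N) (hF : KatoFactThreeAtKP W D.f)
    (hopt : ∀ z ∈ D.L.lattice, ∃ w ∈ periodLattice D.f, z = D.c * w) (h9 : 3 ^ 2 ∣ N) (hsq : IsSquarefull N)
    {q : ℕ} (hq : q.Prime) (hq3 : q ≠ 3) (hqN : q ^ 2 ∣ N) : ¬ (3 : ℤ) ∣ D.c :=
  not_three_dvd_maninConstant_of_degeneracyLoopLawNine_squarefull h68 W D (katoFactThreeAt_of_kp W D.f hF)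
    (additive_of_sq_dvd_level 3 W D.f D.isNewformOf h9) hopt h9 hsq hq hq3 hqN

end Summit.BirchSwinnertonDyer.BirchSwinnertonDyer.Theorems.ManinLocalTwoThree

end
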